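import Literature.Analysis.FluidPDE.AxisymmetricVorticityTransport
import Literature.Analysis.UnboundedOperators.HeatKernel
import HarnessLib

/-!
# The caloric extension commutes with linear isometries; the heat flow preserves axisymmetry

Analysis/FluidPDE proof file (theorems only, no definitions, no named facts), a small step of the
inline programme for `Literature.Analysis.FluidPDE.palasek2021_axisym_quantitative_ess`
(S. Palasek, arXiv:2101.08586, Thm. 1 with `q = 3`; the same statement is the case `p = 3` of
W. S. Ożański – S. Palasek, arXiv:2210.10030 = Ann. PDE 9 (2023), Thm. 1.1).

Both proofs of the off-axis regularity (Palasek, Prop. 8; Ożański–Palasek, Prop. 5.2, "a more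
precise version of Proposition 8 in [Palasek]") apply the **axisymmetric** Bernstein inequality
(Palasek, Prop. 1; tree: `PalasekBernstein.axisym_blockFn_weighted_bound`, which asks for
`‖f(R_θ y)‖ = ‖f(y)‖`) to the Picard iterates `ů_n`, `ũ_n` of an axisymmetric solution, starting
from the caloric term `ů₁(t) = e^{(t−t')Δ}u(t')` (Palasek, §2.4 / Ożański–Palasek, §4.1). That
these iterates are again axisymmetric rests on the equivariance of the heat flow under rotations
about the axis, which this file records for the tree's caloric extension
`UnboundedOperators.heatExtension f t = heatKernel t ⋆ f` (`HeatKernel.lean`) and the tree's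
notions `IsAxisymmetric` / `IsAxisymmetricScalar` (`AxisymmetricEuler.lean`, rotations `rotZ θ`,
linear isometry form `rotZLIE θ` of `AxisymmetricVorticityTransport.lean`):

* `heatExtension_comp_linearIsometryEquiv` — `e^{tΔ}(f ∘ L)(x) = (e^{tΔ}f)(Lx)` for every linear
  isometry `L` of the (finite-dimensional) space (the heat kernel is radial and `L` preserves
  Lebesgue measure); every `t`, including the junk range, both sides being the same integral;
* `heatExtension_continuousLinearEquiv_comp` — `e^{tΔ}(A ∘ f) = A ∘ e^{tΔ}f` for a continuous
  linear equivalence `A` of the target;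
* `IsAxisymmetricScalar.heatExtension`, `IsAxisymmetric.heatExtension` — the heat flow of an
  axisymmetric scalar, resp. of an axisymmetric (rotation-equivariant) vector field on `ℝ³`, is
  axisymmetric.

## References

* S. Palasek, arXiv:2101.08586 (ARMA 242 (2021)), Prop. 1 and proof of Prop. 8. [Palasek2021]
* W. S. Ożański, S. Palasek, arXiv:2210.10030 (Ann. PDE 9 (2023)), §3.1 and Prop. 5.2.
  [OzanskiPalasek2022]
* L. C. Evans, *Partial Differential Equations*, §2.3.1 (the heat kernel is radial). [Evans2010]
-/

noncomputable section

open MeasureTheory Set Function Filter Topology Metric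
open scoped Convolution

namespace Literature.Analysis.FluidPDE

section Isometry

variable {E : Type*} [NormedAddCommGroup E] [InnerProductSpace ℝ E] [FiniteDimensional ℝ E]
  [MeasurableSpace E] [BorelSpace E]
variable {F : Type*} [NormedAddCommGroup F] [NormedSpace ℝ F]

/-- **The caloric extension commutes with linear isometries**: `e^{tΔ}(f ∘ L)(x) = (e^{tΔ}f)(Lx)`
(the heat kernel `heatKernel t y = (4πt)^{-d/2}e^{-|y|²/4t}` is a function of `|y|`, and a linear
isometry of a finite-dimensional inner product space preserves Lebesgue measure). [folklore] -/
theorem heatExtension_comp_linearIsometryEquiv (L : E ≃ₗᵢ[ℝ] E) (f : E → F) (t : ℝ) (x : E) :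
    UnboundedOperators.heatExtension (fun y => f (L y)) t x =
      UnboundedOperators.heatExtension f t (L x) := by
  rw [UnboundedOperators.heatExtension_apply, UnboundedOperators.heatExtension_apply]
  have hmp : MeasurePreserving L volume volume := L.measurePreserving
  -- change of variables `y ↦ L y` in the right-hand integral
  rw [← hmp.integral_comp L.toHomeomorph.measurableEmbedding
    (fun z => UnboundedOperators.heatKernel t z • f (L x - z))]
  congr 1
  funext y
  rw [map_sub, UnboundedOperators.heatKernel_eq, UnboundedOperators.heatKernel_eq, L.norm_map]

/-- **The caloric extension commutes with continuous linear equivalences of the target**: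
`e^{tΔ}(A ∘ f)(x) = A(e^{tΔ}f(x))` (linearity of the Bochner integral; for an equivalence no
integrability hypothesis is needed). [folklore] -/
theorem heatExtension_continuousLinearEquiv_comp {G : Type*} [NormedAddCommGroup G] [NormedSpace ℝ G]
    (A : F ≃L[ℝ] G) (f : E → F) (t : ℝ) (x : E) :
    UnboundedOperators.heatExtension (fun y => A (f y)) t x =
      A (UnboundedOperators.heatExtension f t x) := by
  rw [UnboundedOperators.heatExtension_apply, UnboundedOperators.heatExtension_apply,
    ← A.integral_comp_comm]
  congr 1
  funext y
  rw [map_smul]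

end Isometry

section Axisym

variable {F : Type*} [NormedAddCommGroup F] [NormedSpace ℝ F]

/-- **The heat flow of an axisymmetric scalar is axisymmetric**: if `p ∘ R_θ = p` for all `θ`
then `e^{tΔ}p ∘ R_θ = e^{tΔ}p`. [folklore] -/
theorem IsAxisymmetricScalar.heatExtension {p : EuclideanSpace ℝ (Fin 3) → F} (hp : IsAxisymmetricScalar p) (t : ℝ) :
    IsAxisymmetricScalar (UnboundedOperators.heatExtension p t) := by
  intro θ x
  have h := heatExtension_comp_linearIsometryEquiv (rotZLIE θ) p t x
  simp only [rotZLIE_apply] at h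
  rw [← h]
  congr 1
  funext y
  exact hp θ y

/-- **The heat flow of an axisymmetric vector field is axisymmetric**: if `u(R_θ x) = R_θ u(x)`
for all `θ, x` then the same holds for `e^{tΔ}u` (Palasek, proof of Prop. 8: the caloric Picard
iterate of an axisymmetric solution is axisymmetric, so that Prop. 1 applies to it).
[cite: Palasek2021, proof of Prop. 8] -/
theorem IsAxisymmetric.heatExtension {u : EuclideanSpace ℝ (Fin 3) → EuclideanSpace ℝ (Fin 3)}
    (hu : IsAxisymmetric u) (t : ℝ) :
    IsAxisymmetric (UnboundedOperators.heatExtension u t) := by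
  intro θ x
  have h := heatExtension_comp_linearIsometryEquiv (rotZLIE θ) u t x
  simp only [rotZLIE_apply] at h
  rw [← h]
  have hfun : (fun y => u (rotZ θ y)) = fun y => (rotZLIE θ).toContinuousLinearEquiv (u y) := by
    funext y
    rw [hu θ y]
    rfl
  rw [hfun, heatExtension_continuousLinearEquiv_comp]
  rfl

/-- Consequently the pointwise norm of the heat flow of an axisymmetric vector field is
rotation invariant, `‖e^{tΔ}u(R_θ x)‖ = ‖e^{tΔ}u(x)‖` — the hypothesis of the axisymmetric
Bernstein inequality `PalasekBernstein.axisym_blockFn_weighted_bound`. [folklore] -/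
theorem IsAxisymmetric.norm_heatExtension_rotZ
    {u : EuclideanSpace ℝ (Fin 3) → EuclideanSpace ℝ (Fin 3)} (hu : IsAxisymmetric u) (t θ : ℝ)
    (x : EuclideanSpace ℝ (Fin 3)) :
    ‖UnboundedOperators.heatExtension u t (rotZ θ x)‖ = ‖UnboundedOperators.heatExtension u t x‖ := by
  rw [hu.heatExtension t θ x, norm_rotZ]

end Axisym

end Literature.Analysis.FluidPDE

end
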